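import Literature.AnabelianGeometry.EtaleTheta.Discharge.Sec5OfThetaSetting
import Literature.AnabelianGeometry.EtaleTheta.Discharge.Sec5RootCocycleDiesOnBN
import Literature.AnabelianGeometry.EtaleTheta.SettingGaloisFacts

/-!
# [EtTh] Def. 4.1 (iii)(a) at the §5 data OF THE SETTING: the saturation binder `hD1` from the GALOIS-side clause
# «the base field of `A_N` contains `μ_N`» — no Frobenioid-side dictionary (Def. 4.1 (iii) p.313, §5 p.330–331 / PDF pp.87, 104–105)

Mochizuki, *The étale theta function …*, Publ. RIMS **45** (2009)
[cite: MochizukiEtTh2009, Def 4.1 (iii) p.313 (PDF p.87); §5 p.330–331 (PDF pp.104–105); Lem 5.8 proof p.331 (PDF p.105)].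
abc-iut cell, layer L2, seat abc-iut-L2-t4 (§5 owner, gen 4), ROW W3-L2-01 «§5 GENUINE DATA»; GAP-LEDGER row **G-L6t23-1** (`hD1`).
PROOF-ONLY companion of `Discharge/Sec5OfThetaSetting.lean` (p433549); nothing landed is edited, no definition, no named fact.

THE POINT.  abc-iut-L6-t23's binder (`ThetaEnvData.dies_on_ker_of`, `Discharge/Sec5RootCocycleDiesOnBN.lean`, p418773)
  `hD1 : ∀ k : T.PiYdd, ρ k = 1 → T.chi (T.aug k) = 1`
(«`Ker ρ_N ∩ Π^tp_Ÿ̲̲` acts trivially on `μ_N`», Def. 4.1 (iii)(a): the base field of the `N`-domain `A_N` is `μ_N`-saturated) was so far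
reduced only through the Frobenioid-side dictionary `CyclotomicCharacterCompat(X)` (F-1306/F-1307; abc-iut-L6-t23 gen 5,
`Sec5RootCocycleDiesOfDictionary.lean`).  For the §5 data OF THE SETTING (`ThetaFrobenioid.ofThetaSettingData`, `T := C.thetaEnvData μ hC hS`,
`ιX := id`) the character `T.chi ∘ T.aug` IS the cyclotomic character of `G_K ≤ G_{ℚ_p}` on `μ_N(ℚ̄_p)` composed with the Setting's
augmentation (`chi_aug_thetaEnvData_eq`, `rfl`), and `Ker ρ_N = N_{A_N}` is the stabiliser of a point of the Galois `Π^tp_X̲̲`-set `A_N^bs`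
(`rho_ofThetaSettingData_eq_one_iff`).  Hence `hD1` AT THE SETTING follows from the purely Galois-theoretic reading of clause (a):
* `hD1_ofThetaSettingData_of_stabilizer_fixes_mu` — from «`aug(N_{A_N})` acts trivially on `μ_N(ℚ̄_p)`» (literally: the base field
  `L_{A_N} = ℚ̄_p^{aug(N_{A_N})}` of the covering `A_N^bs` contains `μ_N`);
* `hD1_ofThetaSettingData_of_stabilizer_le_GKN` — from the sufficient condition «`aug(N_{A_N}) ≤ G_{K_N}`», `K_N = K(ζ_N, q_X^{1/N})` of
  [EtTh] §1 p.239 (PDF p.13) (abc-iut-L2-t1's `fieldKN`/`GKN`; `μ_N ⊆ K_N` is abc-iut-L2-t1's `mem_fieldKN_of_pow_eq_one`);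
* tower forms at every level of `ThetaFrobenioidTower.ofThetaSettingFamily` (`…_rhoFamily_…`).
So at the Setting the residual of G-L6t23-1 is ONE Galois-side clause about which open subgroup `N_{A_N} ≤ Π^tp_X̲̲` carries the `N`-th root
— exactly print's (iii)(a) — instead of a dictionary between the Frobenioid's torsion units `μ_N(B_N)` and `μ_N(ℚ̄_p)`.
HONEST FRAMING: kernel-checked implications; the clause stays a hypothesis about the chosen root `R` (the tree's `NthRoot` records
(N,H)-saturation through the abstract predicate `NH`, not through `aug`); nothing of [EtTh] is asserted unconditionally; no side is taken
on anything downstream ([IUTchIII] Cor. 3.12); typed ≠ proved.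
-/

noncomputable section

namespace Literature.AnabelianGeometry.EtaleTheta

open CategoryTheory Opposite Literature.AlgebraicGeometry.Frobenioids Literature.AnabelianGeometry.SemiGraphs
  Literature.AnabelianGeometry.SemiGraphs.GaloisObjects Literature.AlgebraicGeometry.Frobenioids.QuasiTemperoid.BTempConnected

universe v₀

/-! ### `G_{ℚ_p}` on `μ_N(ℚ̄_p)`: pointwise-fixing elements act trivially; `G_{K_N}` fixes `μ_N` -/

section GalMuN

variable {p : ℕ} [Fact p.Prime] (N : ℕ+)

/-- An element of `G_{ℚ_p}` fixing every `N`-th root of unity acts trivially on `μ_N` ([EtTh] Def. 2.10 p.270 (PDF p.44): the action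
"`Π_{μ_N,K} := Δ_{μ_N} ⋊ G_K`" is through the Galois action on `μ_N(K̄)`). [cite: MochizukiEtTh2009, Def 2.10 p.270 (PDF p.44)] -/
theorem galMuN_eq_one_of_forall_apply_eq (σ : GQp p)
    (hσ : ∀ ζ : MuN p N, σ (((ζ : (PadicAlgCl p)ˣ) : PadicAlgCl p)) = ((ζ : (PadicAlgCl p)ˣ) : PadicAlgCl p)) :
    galMuN p N σ = 1 := by
  ext ζ
  rw [galMuN_apply_coe, hσ ζ, MulAut.one_apply]

/-- **`G_{K_N}` acts trivially on `μ_N`**: `K_N = K(ζ_N, q_X^{1/N}) ∋` every `N`-th root of unity ([EtTh] §1 p.239 (PDF p.13)).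
[cite: MochizukiEtTh2009, §1 p.239 (PDF p.13)] -/
theorem galMuN_eq_one_of_mem_fixingSubgroup_fieldKN (K : IntermediateField ℚ_[p] (PadicAlgCl p)) (q : PadicAlgCl p) (σ : GQp p)
    (hσ : σ ∈ (fieldKN K q N).fixingSubgroup) : galMuN p N σ = 1 := by
  refine galMuN_eq_one_of_forall_apply_eq N σ fun ζ => ?_
  rw [IntermediateField.mem_fixingSubgroup_iff] at hσ
  refine hσ _ (mem_fieldKN_of_pow_eq_one K q ?_)
  have h := ζ.2
  rw [mem_rootsOfUnity] at h
  have h2 := congrArg Units.val h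
  rwa [Units.val_pow_eq_pow_val, Units.val_one] at h2

end GalMuN

/-! ### The character of the §2 datum of the Setting IS the cyclotomic character through `aug` -/

namespace ThetaSetting.EtaleThetaData.DoubleUnderline

variable {p : ℕ} [Fact p.Prime] {D : ThetaSetting p} {E : D.EtaleThetaData} {l : ℕ} (C : E.DoubleUnderline l) {N : ℕ+}
  (μ : D.CyclotomeMod l N) (hC : D.Compat) (hS : D.Sec2Hyps)

/-- For abc-iut-L2-t8's `C.thetaEnvData μ hC hS`: `χ(aug(k)) = galMuN (aug k)` — the mod-`N` cyclotomic character of the §2 datum is the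
Galois action of `G_K ≤ G_{ℚ_p}` on `μ_N(ℚ̄_p)` composed with the Setting's augmentation (definitionally).
[cite: MochizukiEtTh2009, Def 2.13 p.273 (PDF p.47)] -/
theorem chi_aug_thetaEnvData_eq (k : C.Huu) :
    (C.thetaEnvData μ hC hS).chi ((C.thetaEnvData μ hC hS).aug k) = galMuN p N (D.aug (k : D.PiTemp)) := rfl

end ThetaSetting.EtaleThetaData.DoubleUnderline

/-! ### `hD1` at the §5 data of the Setting from the Galois-side clause (a) -/

namespace ThetaFrobenioid

variable {p : ℕ} [Fact p.Prime] {D : ThetaSetting p} {E : D.EtaleThetaData} {l : ℕ} {C : E.DoubleUnderline l}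
  {e : D.toTemperedCurve.GroupLevelData} {N : ℕ+} (μ : D.CyclotomeMod l N) (hC : D.Compat) (hS : D.Sec2Hyps)
  {D₀ : Type} [Category.{v₀} D₀] {V : FrdIMonoidStub.{0}} {T₀ : RealifiedDivisorMonoids (D₀ := D₀) V}
  {VD : FrdICatStub.{1, 0, 0} (ConnectedPart (BTemp (C.temperedArithmeticGroup e).Pi))}
  {tf : TemperedFrobenioid T₀ (ConnectedPart (BTemp (C.temperedArithmeticGroup e).Pi)) VD} {hZ : tf.monoidType = MonoidType.Z}
  {hP : ∀ A : (ConnectedPart (BTemp (C.temperedArithmeticGroup e).Pi))ᵒᵖ, IsPerfect (tf.Φ.carrier A)}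
  {NH : Subgroup (Field.absoluteGaloisGroup D.K) → tf.category → ℕ+ → Prop} {A₀ : tf.category}
  {hA₀ : PreFrobenioid.IsFrobeniusTrivial tf.toElem A₀} {hA₀' : SemiGraphs.IsGaloisObj A₀.base.obj}
  {pullFrac : ∀ {A A' : (BiKummerSetting.mkOfConnectedTemperoid (C.temperedArithmeticGroup e) tf hZ hP NH A₀ hA₀ hA₀').C} (_ : A' ⟶ A),
    (BiKummerSetting.mkOfConnectedTemperoid (C.temperedArithmeticGroup e) tf hZ hP NH A₀ hA₀ hA₀').biratUnits A →
      (BiKummerSetting.mkOfConnectedTemperoid (C.temperedArithmeticGroup e) tf hZ hP NH A₀ hA₀ hA₀').biratUnits A'}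
  {θ : (BiKummerSetting.mkOfConnectedTemperoid (C.temperedArithmeticGroup e) tf hZ hP NH A₀ hA₀ hA₀').biratUnits
    (BiKummerSetting.mkOfConnectedTemperoid (C.temperedArithmeticGroup e) tf hZ hP NH A₀ hA₀ hA₀').Aodot}
  {Bl : (BiKummerSetting.mkOfConnectedTemperoid (C.temperedArithmeticGroup e) tf hZ hP NH A₀ hA₀ hA₀').C}
  {Pl : (BiKummerSetting.mkOfConnectedTemperoid (C.temperedArithmeticGroup e) tf hZ hP NH A₀ hA₀ hA₀').FractionPair θ Bl}
  {Rl : (BiKummerSetting.mkOfConnectedTemperoid (C.temperedArithmeticGroup e) tf hZ hP NH A₀ hA₀ hA₀').NthRoot θ Pl C.lPNat pullFrac}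
  (h : ModelFrobenioid.Hypotheses tf.divisorMonoid tf.ratFnFunctor)
  (Q : FrobenioidTheta.ThetaSubquotientStub.{0} (ConnectedPart (BTemp (C.temperedArithmeticGroup e).Pi)))
  (R : (BiKummerSetting.mkOfConnectedTemperoid (C.temperedArithmeticGroup e) tf hZ hP NH A₀ hA₀ hA₀').NthRoot Rl.root Rl.pair N pullFrac)
  (K' : Type) [Field K'] (constEmb : K'ˣ →* tf.biratUnitsModel R.BN) (constEmb_injective : Function.Injective constEmb)
  (hinvc : ∀ g : Aut R.AN.base,
    pull tf.divisorMonoid g.hom (ModelFrobenioid.div R.pair.num) = ModelFrobenioid.div R.pair.num)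
  (hinvp : ∀ y : (C.thetaEnvData μ hC hS).PiX, y ∈ (C.thetaEnvData μ hC hS).PiYdd →
    pull tf.divisorMonoid ((BiKummerSetting.mkOfConnectedTemperoid (C.temperedArithmeticGroup e) tf hZ hP NH A₀ hA₀ hA₀').galoisSurj
      R.AN.base R.αData.isGalois ((ContinuousMulEquiv.refl _) y)).hom (ModelFrobenioid.div R.pair.den) = ModelFrobenioid.div R.pair.den)

/-- **`hD1` for the §5 data of the Setting from clause (a) in Galois form** (Def. 4.1 (iii)(a) p.313: "`A''` [hence the base field of
`A_N`] is `(N, H_⊙^{bs-fld})`-saturated … (a) `μ_N`-saturated"): if the stabiliser `N_{A_N} ≤ Π^tp_X̲̲` of a point `a` of `A_N^bs` acts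
trivially on `μ_N(ℚ̄_p)` through `aug` — i.e. the field `ℚ̄_p^{aug(N_{A_N})}` over which the covering `A_N^bs` is defined contains `μ_N` —
then `Ker ρ_N ∩ Π^tp_Ÿ̲̲` acts trivially on the cyclotome `μ_N` of the §2 datum: abc-iut-L6-t23's binder `hD1` verbatim
(`ρ := (ofThetaSettingData …).ρ`).  [cite: MochizukiEtTh2009, Def 4.1 (iii) p.313 (PDF p.87); §5 p.331 (PDF p.105)] -/
theorem hD1_ofThetaSettingData_of_stabilizer_fixes_mu (a : R.AN.base.obj.obj.V)
    (hμN : ∀ g : C.Huu, R.AN.base.obj.obj.ρ g a = a → galMuN p N (D.aug (g : D.PiTemp)) = 1) :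
    ∀ k : (C.thetaEnvData μ hC hS).PiYdd,
      (ofThetaSettingData μ hC hS h Q R K' constEmb constEmb_injective hinvc hinvp).ρ (k : (C.thetaEnvData μ hC hS).PiX) = 1 →
        (C.thetaEnvData μ hC hS).chi ((C.thetaEnvData μ hC hS).aug (k : (C.thetaEnvData μ hC hS).PiX)) = 1 := by
  intro k hk
  rw [rho_ofThetaSettingData_eq_one_iff μ hC hS h Q R K' constEmb constEmb_injective hinvc hinvp a] at hk
  exact hμN _ hk

/-- **`hD1` for the §5 data of the Setting from «`aug(N_{A_N}) ≤ G_{K_N}`»** (`K_N = K(ζ_N, q_X^{1/N})`, [EtTh] §1 p.239 (PDF p.13);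
sufficient for clause (a) since `μ_N ⊆ K_N`).  [cite: MochizukiEtTh2009, Def 4.1 (iii) p.313 (PDF p.87); §1 p.239 (PDF p.13)] -/
theorem hD1_ofThetaSettingData_of_stabilizer_le_GKN (a : R.AN.base.obj.obj.V)
    (hKN : ∀ g : C.Huu, R.AN.base.obj.obj.ρ g a = a → D.aug (g : D.PiTemp) ∈ D.GKN N) :
    ∀ k : (C.thetaEnvData μ hC hS).PiYdd,
      (ofThetaSettingData μ hC hS h Q R K' constEmb constEmb_injective hinvc hinvp).ρ (k : (C.thetaEnvData μ hC hS).PiX) = 1 →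
        (C.thetaEnvData μ hC hS).chi ((C.thetaEnvData μ hC hS).aug (k : (C.thetaEnvData μ hC hS).PiX)) = 1 :=
  hD1_ofThetaSettingData_of_stabilizer_fixes_mu μ hC hS h Q R K' constEmb constEmb_injective hinvc hinvp a fun g hg =>
    galMuN_eq_one_of_mem_fixingSubgroup_fieldKN N D.K D.qX _ (hKN g hg)

/-- Hence (abc-iut-L6-t23's `dies_on_ker_of`, p418773): at the §5 data of the Setting, **every mod-`N` theta cocycle dies on
`Ker ρ_N ∩ Π^tp_Ÿ̲̲`** given the Galois-side clause (a) and the class-side clause (D2) (Def. 4.1 (iii)(b) + Kummer theory; GAP G-L6t23-2,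
kept by name).  [cite: MochizukiEtTh2009, Def 4.1 (iii) p.313 (PDF p.87); Prop 5.2 (iii) p.324 (PDF p.98)] -/
theorem thetaCocycle_dies_on_ker_rho_ofThetaSettingData (a : R.AN.base.obj.obj.V)
    (hμN : ∀ g : C.Huu, R.AN.base.obj.obj.ρ g a = a → galMuN p N (D.aug (g : D.PiTemp)) = 1)
    (hD2 : ∀ η ∈ (C.thetaEnvData μ hC hS).thetaCocycles, ∃ c : (C.thetaEnvData μ hC hS).mu,
      ∀ k : (C.thetaEnvData μ hC hS).PiYdd,
        (ofThetaSettingData μ hC hS h Q R K' constEmb constEmb_injective hinvc hinvp).ρ (k : (C.thetaEnvData μ hC hS).PiX) = 1 →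
          η k = CycEnvelope.coboundary ((C.thetaEnvData μ hC hS).aug.comp (C.thetaEnvData μ hC hS).PiYdd.subtype)
            (C.thetaEnvData μ hC hS).chi c k) :
    ∀ η ∈ (C.thetaEnvData μ hC hS).thetaCocycles, ∀ k : (C.thetaEnvData μ hC hS).PiYdd,
      (ofThetaSettingData μ hC hS h Q R K' constEmb constEmb_injective hinvc hinvp).ρ (k : (C.thetaEnvData μ hC hS).PiX) = 1 →
        η k = 1 :=
  (C.thetaEnvData μ hC hS).dies_on_ker_of (ofThetaSettingData μ hC hS h Q R K' constEmb constEmb_injective hinvc hinvp).ρ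
    (hD1_ofThetaSettingData_of_stabilizer_fixes_mu μ hC hS h Q R K' constEmb constEmb_injective hinvc hinvp a hμN) hD2

end ThetaFrobenioid

end Literature.AnabelianGeometry.EtaleTheta

end
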